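import Literature.MeasureTheory.Group.CoveringWeightsAveraging
import HarnessLib

/-!
# Vanishing of unfolded integrals with a cuspidal factor

Topic `MeasureTheory/Group`; namespace `Literature.MeasureTheory.Group`. Proof file (theorems only),
the payoff of `CoveringWeights`, `CoveringWeightsBochner` and `CoveringWeightsAveraging`: the
classical argument "unfold the sum over `Γ'\Γ`, then integrate first over the compact quotient
`(U ∩ Γ')\U` of a normalised abelian subgroup, where the period of the cusp form vanishes"
(Godement–Jacquet (1972), §12: the theta series attached to singular matrices are orthogonal to cusp
forms; Jacquet–Shalika (1981), §4), in the covering-weight formalism on the group: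

* `le_one_of_coveringSum_eq_one` — a weight with covering sums `1` is `≤ 1`;
* `integral_wt_mul_mul_tsum_eq_zero_of_period_eq_zero` — **for `ψ` `Γ`-invariant with vanishing
  `U`-periods `∫_𝓕 ψ(u⁻¹ • x) dμU = 0`, `f` `Γ'`- and `U`-invariant, `β` a `Γ`-weight, and
  `∫ β |ψ| Σ_i |f(s_i • ·)| dν < ∞` (`s_i` representatives of `Γ'\Γ`):
  `∫ β(x) ψ(x) Σ_i f(s_i • x) dν(x) = 0`.**

## References

* R. Godement, H. Jacquet, *Zeta functions of simple algebras*, LNM 260 (1972), §12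
  [GodementJacquetLNM260].
* H. Jacquet, J. A. Shalika, Amer. J. Math. 103 (1981), §4 [JacquetShalikaAJM1981].
-/

noncomputable section

open _root_.MeasureTheory _root_.MeasureTheory.Measure Set Filter Function
open scoped ENNReal NNReal Pointwise

namespace Literature.MeasureTheory.Group

section Vanishing

variable {G : Type*} [Group G] [MeasurableSpace G] [MeasurableMul₂ G] [MeasurableInv G]
  {X : Type*} [MulAction G X] [MeasurableSpace X] [MeasurableSMul₂ G X]
  (ν : Measure X) [SFinite ν] [SMulInvariantMeasure G X ν]
  (Γ Γ' : Subgroup G) [Countable Γ] (U : Subgroup G) (μU : Measure U) [SFinite μU]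

omit [MeasurableSpace G] [MeasurableMul₂ G] [MeasurableInv G] [MeasurableSpace X] [MeasurableSMul₂ G X] in
/-- A weight with covering sums `1` is pointwise `≤ 1`. [folklore] -/
theorem le_one_of_coveringSum_eq_one {Δ : Subgroup G} {β : X → ℝ≥0∞} (hβ : ∀ x, coveringSum Δ β x = 1)
    (x : X) : β x ≤ 1 := by
  calc β x = β ((1 : Δ) • x) := by rw [one_smul]
    _ ≤ ∑' γ : Δ, β (γ • x) := ENNReal.le_tsum (1 : Δ)
    _ = 1 := hβ x

/-- **Vanishing of an unfolded integral against a cuspidal factor.** Setting: `Γ' ≤ Γ ≤ G`, `Γ`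
countable, acting on `(X, ν)` (`ν` s-finite and `G`-invariant); `U ≤ G` a commutative subgroup
normalised by `Γ'`, with a measure `μU` invariant under `U ∩ Γ'`, commuting with `Γ'` in the mean,
and a strict measurable fundamental domain `𝓕` of `U ∩ Γ'` in `U` of finite positive measure (the
hypotheses of `coveringSum_avgWeight_eq_one`); `β` a `Γ`-weight and `β₁` a `Γ'`-weight with
covering sums `1`; `s i ∈ Γ` representatives of `Γ'\Γ`. Let `ψ : X → ℂ` be strongly measurable and
`Γ`-invariant with **vanishing `U`-periods** `∫_𝓕 ψ(u⁻¹ • x) dμU(u) = 0` for all `x` (cuspidality),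
and `f : X → ℂ` strongly measurable, `Γ'`-invariant and `U`-invariant. If
`∫ β |ψ| Σ_i |f(s i • ·)| dν < ∞` then

  `∫ β(x) ψ(x) Σ_i f(s i • x) dν(x) = 0`.

Proof: `Σ_i f(s i • x) ψ(x) = Σ_i (ψ f)(s i • x)`; unfold to `Γ'` with the *averaged* weight
`β₁♭` (`integral_wt_smul_eq_integral_wt_smul_tsum`, `coveringSum_avgWeight_eq_one`), then average
over `𝓕` (`integral_wt_avgWeight_smul_eq`): the `𝓕`-average of `ψ f` is `f · (∫_𝓕 ψ(u⁻¹ • ·)) = 0`.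
This is the classical argument "unfold, then integrate first over `N(K)\\N(𝔸)`" showing that theta
series attached to singular matrices (or Eisenstein-type sums induced from a proper parabolic) are
orthogonal to cusp forms (Godement–Jacquet (1972), §12, Lemma 12.x; Jacquet–Shalika (1981), §4),
in the covering-weight language of the tree. [cite: GodementJacquetLNM260, §12] -/
theorem integral_wt_mul_mul_tsum_eq_zero_of_period_eq_zero [Countable (Γ'.subgroupOf U)]
    (hle : Γ' ≤ Γ)
    -- the unipotent subgroup and its fundamental domain
    (hnorm : ∀ γ ∈ Γ', ∀ u ∈ U, γ * u * γ⁻¹ ∈ U) (hU : ∀ a b : U, a * b = b * a)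
    (hleft : ∀ η : Γ'.subgroupOf U, ∀ g : U → ℝ≥0∞, Measurable g →
      ∫⁻ u, g ((η : U) * u) ∂μU = ∫⁻ u, g u ∂μU)
    (hcomm : ∀ (γ : Γ') (x : X) (g : X → ℝ≥0∞), Measurable g →
      ∫⁻ u : U, g ((γ : G) • (u : G) • x) ∂μU = ∫⁻ u : U, g ((u : G) • (γ : G) • x) ∂μU)
    {𝓕 : Set U} (h𝓕m : MeasurableSet 𝓕) (h𝓕 : ∀ u : U, ∃! η : Γ'.subgroupOf U, ((η : U) * u) ∈ 𝓕)
    (h𝓕₀ : μU 𝓕 ≠ 0) (h𝓕top : μU 𝓕 ≠ ∞)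
    -- the weights
    {β β₁ : X → ℝ≥0∞} (hβ : Measurable β) (hβw : ∀ x, coveringSum Γ β x = 1)
    (hβ₁ : Measurable β₁) (hβ₁w : ∀ x, coveringSum Γ' β₁ x = 1)
    -- the representatives of `Γ'\Γ`
    {ι : Type*} [Countable ι] {s : ι → G} (hsΓ : ∀ i, s i ∈ Γ) (hs : ∀ γ ∈ Γ, ∃! i, γ * (s i)⁻¹ ∈ Γ')
    -- the functions
    {ψ f : X → ℂ} (hψm : StronglyMeasurable ψ) (hψinv : ∀ γ ∈ Γ, ∀ x, ψ (γ • x) = ψ x)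
    (hψcusp : ∀ x, ∫ u in 𝓕, ψ ((u : G)⁻¹ • x) ∂μU = 0)
    (hfm : StronglyMeasurable f) (hfinv : ∀ γ ∈ Γ', ∀ x, f (γ • x) = f x)
    (hfU : ∀ u : U, ∀ x, f ((u : G) • x) = f x)
    (hint : ∫⁻ x, β x * ‖ψ x‖ₑ * ∑' i, ‖f (s i • x)‖ₑ ∂ν < ∞) :
    ∫ x, wt β x • (ψ x * ∑' i, f (s i • x)) ∂ν = 0 := by
  haveI : Countable Γ' := (Subgroup.inclusion_injective hle).countable
  -- the `Γ'`-invariant function `F = ψ f`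
  set F : X → ℂ := fun x => ψ x * f x with hF
  have hFm : StronglyMeasurable F := hψm.mul hfm
  have hFinv : ∀ γ ∈ Γ', ∀ x, F (γ • x) = F x := fun γ hγ x => by
    simp only [hF, hψinv γ (hle hγ) x, hfinv γ hγ x]
  have hFsum : ∀ x, ψ x * ∑' i, f (s i • x) = ∑' i, F (s i • x) := fun x => by
    simp only [hF]
    rw [← tsum_mul_left]
    exact tsum_congr fun i => by rw [hψinv (s i) (hsΓ i) x]
  -- the averaged weight `β' = β₁♭` is a `Γ'`-weight
  set β' : X → ℝ≥0∞ := avgWeight U μU 𝓕 β₁ with hβ'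
  have hβ'm : Measurable β' := measurable_avgWeight U μU hβ₁
  have hβ'w : ∀ x, coveringSum Γ' β' x = 1 :=
    coveringSum_avgWeight_eq_one Γ' U μU hnorm hU hleft hcomm h𝓕m h𝓕 h𝓕₀ h𝓕top hβ₁ hβ₁w
  -- finiteness on the `Γ'` side, by Tonelli unfolding
  have hnorm_sum : ∀ x, (‖F x‖ₑ : ℝ≥0∞) = ‖ψ x‖ₑ * ‖f x‖ₑ := fun x => enorm_mul _ _
  have hint' : ∫⁻ x, ‖F x‖ₑ * β' x ∂ν < ∞ := by
    have hFe : Measurable fun x => (‖F x‖ₑ : ℝ≥0∞) := hFm.enorm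
    have hFeinv : ∀ γ ∈ Γ', ∀ x, (‖F (γ • x)‖ₑ : ℝ≥0∞) = ‖F x‖ₑ := fun γ hγ x => by rw [hFinv γ hγ x]
    rw [lintegral_mul_eq_lintegral_tsum_mul ν Γ Γ' hle hFe hFeinv hβ'm hβ'w hβ hβw hsΓ hs]
    refine lt_of_le_of_lt (lintegral_mono fun x => le_of_eq ?_) hint
    show (∑' i, (‖F (s i • x)‖ₑ : ℝ≥0∞)) * β x = β x * ‖ψ x‖ₑ * ∑' i, (‖f (s i • x)‖ₑ : ℝ≥0∞)
    rw [mul_comm, mul_assoc]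
    congr 1
    rw [← ENNReal.tsum_mul_left]
    exact tsum_congr fun i => by rw [hnorm_sum, hψinv (s i) (hsΓ i) x]
  -- unfold to `Γ'`
  have step1 : ∫ x, wt β x • (ψ x * ∑' i, f (s i • x)) ∂ν = ∫ x, wt β' x • F x ∂ν := by
    rw [integral_wt_smul_eq_integral_wt_smul_tsum ν Γ Γ' hle hFm hFinv hβ'm hβ'w hβ hβw hsΓ hs hint']
    exact integral_congr_ae (ae_of_all _ fun x => by simp only [hFsum x])
  -- average over `𝓕`
  have hβ₁le : ∀ y, β₁ y ≤ 1 := le_one_of_coveringSum_eq_one hβ₁w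
  have hintB : ∫⁻ y, ‖F y‖ₑ * avgWeight U μU 𝓕 β₁ y ∂ν < ∞ := hint'
  have step2 := integral_wt_avgWeight_smul_eq U μU ν h𝓕₀ h𝓕top hβ₁ hβ₁le hFm hintB
  have havg : ∀ y, ∫ u in 𝓕, F ((u : G)⁻¹ • y) ∂μU = 0 := by
    intro y
    simp only [hF]
    have hf' : ∀ u : U, f ((u : G)⁻¹ • y) = f y := fun u => by
      have h := hfU u⁻¹ y
      rwa [Subgroup.coe_inv] at h
    simp_rw [hf']
    rw [integral_mul_const, hψcusp y, zero_mul]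
  rw [step1, hβ', step2]
  simp_rw [havg, smul_zero]
  exact integral_zero _ _

end Vanishing

end Literature.MeasureTheory.Group
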